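import Literature.Claims.NS.Ruzmaikina2008
import Summits.NavierStokesRegularity.NavierStokesRegularity.Theorems.SoloRefuteRamm2024
import Literature.Analysis.FluidPDE.NSVorticityBKMLocalExistence
import Literature.Analysis.FluidPDE.NSLerayHopfSereginEnergyProofs
import Literature.Analysis.FluidPDE.TaoLocalisation
import Literature.Analysis.FluidPDE.CriticalRegularityScaling
import Literature.Analysis.FluidPDE.SelfSimilarProofs
import Literature.Analysis.FluidPDE.VorticityCalculus
import Mathlib.MeasureTheory.Measure.Lebesgue.EqHaar
import Mathlib.Analysis.Calculus.FDeriv.Equiv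
import HarnessLib

/-!
# C25 `Ruzmaikina2008` (D-0090 NS-CLAIMS SWEEP) — the norm comparison `|ω|_q ≤ |ω|_∞` fails in the class

A. A. Ruzmaikina, arXiv:0810.0318v2: (51) second inequality p. 21, (58) second inequality p. 22 and
the chain "`|ω|₂(t) ≤ |ω|_∞(t)`" of (60)–(61) p. 22–23 bound an `L^q(ℝ³)` norm of the vorticity
by its `L^∞(ℝ³)` norm with constant `1`.  Typed (skeleton `Literature.Claims.NS.Ruzmaikina2008`,
decl `NormComparison`) for the vorticity slices of solutions in the paper's class (classical
Navier–Stokes solution on a slab with all `L²` Sobolev norms bounded), `2 ≤ q < ∞`.  DOWNSTREAM of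
the first failing step `Inference50` (file `SoloRefuteRuzmaikina2008`); recorded for the erratum
column.

Refutation at SOLUTION level: spread the divergence-free test datum `curl(φ e₃)` of
`SoloRefuteRamm2024` by a dilation `x ↦ c x` (`0 < c ≪ 1`); its vorticity `c (curl curl(φe₃))(c x)`
then has `L²` norm `c · c^{-3/2} ‖curl curl(φe₃)‖₂` exceeding its `L^∞` norm
`c ‖curl curl(φe₃)‖_∞` (the vorticity `curl curl(φ e₃)` is not identically zero: its first
component is `∂₃∂₁φ`, and `∂₁φ ≢ 0` has compact support).  The tree's local existence theorem in
the Beale–Kato–Majda class (`MajdaBertozzi2002_localExistenceH3_holds`) evolves this datum into a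
solution of the typed class on some `[0, τ]`, and at `t = 0` the typed comparison with `q = 2` fails.

WHAT THIS IS NOT: not a claim about NS regularity or blow-up; not a claim about any author beyond
the typed locator.
-/

set_option linter.dupNamespace false

noncomputable section

open MeasureTheory Metric Set
open scoped ENNReal NNReal ContDiff
open Literature.Analysis.FluidPDE

namespace Summit.NavierStokesRegularity.NavierStokesRegularity.Theorems.Ruzmaikina2008

open Literature.Claims.NS.Ruzmaikina2008
open Summit.NavierStokesRegularity.NavierStokesRegularity.Theorems.Ramm2024
  (bump bumpFn potential testDatum contDiff_bumpFn contDiff_testDatum hasCompactSupport_testDatum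
    isDivFree_testDatum testDatum_apply_one testDatum_ne_zero)

/-- Change of variables in `L^p(ℝ³; ℝ³)`: `‖f(c ·)‖_{L^p} = |c³|^{-1/p} ‖f‖_{L^p}` for `c ≠ 0`
(vector-valued twin of the tree's scalar `eLpNorm_comp_smul_three`). -/
theorem eLpNorm_comp_smul_field (p : ℝ≥0∞)
    (f : EuclideanSpace ℝ (Fin 3) → EuclideanSpace ℝ (Fin 3)) {c : ℝ} (hc : c ≠ 0) :
    eLpNorm (fun x => f (c • x)) p volume =
      ENNReal.ofReal |(c ^ 3)⁻¹| ^ (1 / p).toReal * eLpNorm f p volume := by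
  have hemb : MeasurableEmbedding (fun x : EuclideanSpace ℝ (Fin 3) => c • x) :=
    (Homeomorph.smul (Units.mk0 c hc)).measurableEmbedding
  have h0 : ENNReal.ofReal |(c ^ 3)⁻¹| ≠ 0 :=
    (ENNReal.ofReal_pos.2 (abs_pos.2 (inv_ne_zero (pow_ne_zero _ hc)))).ne'
  rw [← Function.comp_def f, ← hemb.eLpNorm_map_measure, Measure.map_addHaar_smul volume hc,
    finrank_euclideanSpace_fin, eLpNorm_smul_measure_of_ne_zero h0, smul_eq_mul]

/-- The curl of a dilation: `curl (v(c ·))(x) = c • (curl v)(c x)` (no differentiability needed: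
Mathlib's `fderiv_comp_smul`). -/
theorem curl_comp_smul (v : EuclideanSpace ℝ (Fin 3) → EuclideanSpace ℝ (Fin 3)) (c : ℝ)
    (x : EuclideanSpace ℝ (Fin 3)) : curl (fun y => v (c • y)) x = c • curl v (c • x) := by
  simp only [curl, fderiv_comp_smul]
  ext i
  fin_cases i <;> simp [Matrix.cons_val_zero, Matrix.cons_val_one] <;> ring

/-- **Spreading out beats `L^∞`.** For a nonzero continuous compactly supported field `g` on `ℝ³`
and finite `p ≠ 0` there is a dilation-with-amplitude `x ↦ c g(c x)`, `0 < c`, whose (finite) `L^p`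
norm is strictly larger than its `L^∞` norm: `‖c g(c·)‖_∞ = c‖g‖_∞`, `‖c g(c·)‖_p =
c^{1−3/p}‖g‖_p`. -/
theorem exists_smul_comp_smul_top_lt {g : EuclideanSpace ℝ (Fin 3) → EuclideanSpace ℝ (Fin 3)}
    (hcont : Continuous g) (hcs : HasCompactSupport g) (hne : g ≠ 0) (p : ℝ≥0∞) (hp0 : p ≠ 0)
    (hptop : p ≠ ⊤) :
    ∃ c : ℝ, 0 < c ∧ eLpNorm (fun x => c • g (c • x)) p volume < ⊤ ∧
      eLpNorm (fun x => c • g (c • x)) ⊤ volume < eLpNorm (fun x => c • g (c • x)) p volume := by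
  -- the two norms of the undilated field
  set a : ℝ≥0∞ := eLpNorm g ⊤ volume with ha
  set b : ℝ≥0∞ := eLpNorm g p volume with hb
  have hatop : a ≠ ⊤ := (hcont.memLp_of_hasCompactSupport hcs).2.ne
  have hbtop : b ≠ ⊤ := (hcont.memLp_of_hasCompactSupport hcs).2.ne
  have hb0 : b ≠ 0 := by
    intro h0
    rw [hb, eLpNorm_eq_zero_iff hcont.aestronglyMeasurable hp0] at h0
    exact hne ((hcont.ae_eq_iff_eq volume continuous_const).mp h0)
  have hbpos : 0 < b.toReal := ENNReal.toReal_pos hb0 hbtop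
  -- dilation parameter: |c³|⁻¹ = M^p with M = a/b + 2
  obtain ⟨M, hM⟩ : ∃ M : ℝ, M = a.toReal / b.toReal + 2 := ⟨_, rfl⟩
  have hMpos : 0 < M := by
    have := div_nonneg (ENNReal.toReal_nonneg (a := a)) hbpos.le; rw [hM]; linarith
  obtain ⟨c, hc⟩ : ∃ c : ℝ, c = (M ^ (p.toReal / 3))⁻¹ := ⟨_, rfl⟩
  have hcpos : 0 < c := by rw [hc]; exact inv_pos.mpr (Real.rpow_pos_of_pos hMpos _)
  have hc0 : c ≠ 0 := hcpos.ne'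
  have hc3 : |(c ^ 3)⁻¹| = M ^ p.toReal := by
    rw [abs_of_pos (by positivity), hc, inv_pow, inv_inv, ← Real.rpow_natCast,
      ← Real.rpow_mul hMpos.le]
    norm_num
  have hptr : 0 < p.toReal := ENNReal.toReal_pos hp0 hptop
  have hsmul : (fun x => c • g (c • x)) = c • fun x => g (c • x) := rfl
  have hcne : ‖c‖ₑ ≠ 0 := by simpa using hc0
  refine ⟨c, hcpos, ?_, ?_⟩
  · rw [hsmul, eLpNorm_const_smul, eLpNorm_comp_smul_field p g hc0]
    exact ENNReal.mul_lt_top enorm_lt_top (ENNReal.mul_lt_top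
      (ENNReal.rpow_lt_top_of_nonneg (by positivity) ENNReal.ofReal_ne_top) hbtop.lt_top)
  · rw [hsmul, eLpNorm_const_smul, eLpNorm_const_smul, ENNReal.mul_lt_mul_iff_right hcne enorm_ne_top,
      eLpNorm_top_comp_smul g hc0, eLpNorm_comp_smul_field p g hc0, hc3, ← hb, ← ha]
    have hexp : (1 / p).toReal = 1 / p.toReal := by
      rw [one_div, ENNReal.toReal_inv, one_div]
    rw [hexp, ENNReal.ofReal_rpow_of_pos (Real.rpow_pos_of_pos hMpos _), ← Real.rpow_mul hMpos.le,
      mul_one_div_cancel hptr.ne', Real.rpow_one]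
    -- a < M * b
    rw [← ENNReal.ofReal_toReal hatop, ← ENNReal.ofReal_toReal hbtop, ← ENNReal.ofReal_mul hMpos.le,
      ENNReal.ofReal_lt_ofReal_iff (by positivity)]
    rw [hM, add_mul, div_mul_cancel₀ _ hbpos.ne']
    linarith

/-- The third component of the test datum vanishes: `(curl (φ e₃)) x 2 = ∂₁(φe₃)₂ − ∂₂(φe₃)₁ = 0`. -/
theorem testDatum_apply_two (x : EuclideanSpace ℝ (Fin 3)) : testDatum x 2 = 0 := by
  have hφ : DifferentiableAt ℝ bumpFn x := (contDiff_bumpFn.differentiable (by simp)) x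
  simp only [testDatum]
  rw [show potential = fun y => bumpFn y • EuclideanSpace.single (2 : Fin 3) (1 : ℝ) from rfl,
    curl_eq_curlCLM, curlCLM_apply, fderiv_smul_const hφ]
  simp

/-- **The vorticity of the test datum is not identically zero.** If `curl curl(φ e₃) ≡ 0`, its
first component `∂₃∂₁φ` vanishes, so `∂₁φ` is constant along `x₃`-lines; being compactly supported
it vanishes identically, so `φ` is constant along `x₁`-lines — but `φ(e₁) = 1`, `φ(2e₁) = 0`. -/
theorem curl_testDatum_ne_zero : curl testDatum ≠ 0 := by
  intro h
  have hdiff : Differentiable ℝ testDatum := contDiff_testDatum.differentiable (by simp)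
  -- F := ∂₁φ = (y ↦ Dφ(y) e₁) is smooth
  have hFs : ContDiff ℝ ∞ fun y : EuclideanSpace ℝ (Fin 3) =>
      fderiv ℝ bumpFn y (EuclideanSpace.single (0 : Fin 3) (1 : ℝ)) :=
    (contDiff_infty_iff_fderiv.1 contDiff_bumpFn).2.clm_apply contDiff_const
  have hFd : Differentiable ℝ fun y : EuclideanSpace ℝ (Fin 3) =>
      fderiv ℝ bumpFn y (EuclideanSpace.single (0 : Fin 3) (1 : ℝ)) := hFs.differentiable (by simp)
  -- components of `D(testDatum)`
  have hcoord : ∀ (x a : EuclideanSpace ℝ (Fin 3)) (i : Fin 3),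
      fderiv ℝ testDatum x a i = fderiv ℝ (fun y => testDatum y i) x a := by
    intro x a i
    have hh : (fun y => testDatum y i) =
        (EuclideanSpace.proj i : EuclideanSpace ℝ (Fin 3) →L[ℝ] ℝ) ∘ testDatum := rfl
    rw [hh, ((EuclideanSpace.proj i).hasFDerivAt.comp x (hdiff x).hasFDerivAt).fderiv]
    rfl
  -- Step 1: `∂₃ F ≡ 0` from the first component of `curl testDatum ≡ 0`
  have hstep1 : ∀ x : EuclideanSpace ℝ (Fin 3),
      fderiv ℝ (fun y : EuclideanSpace ℝ (Fin 3) =>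
        fderiv ℝ bumpFn y (EuclideanSpace.single (0 : Fin 3) (1 : ℝ))) x
        (EuclideanSpace.single (2 : Fin 3) (1 : ℝ)) = 0 := by
    intro x
    have hx : curl testDatum x 0 = 0 := by rw [h]; rfl
    have hc0 : curl testDatum x 0 =
        fderiv ℝ testDatum x (EuclideanSpace.single (1 : Fin 3) (1 : ℝ)) 2 -
          fderiv ℝ testDatum x (EuclideanSpace.single (2 : Fin 3) (1 : ℝ)) 1 := by
      simp [curl]
    have h2 : fderiv ℝ testDatum x (EuclideanSpace.single (1 : Fin 3) (1 : ℝ)) 2 = 0 := by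
      rw [hcoord, show (fun y => testDatum y 2) = fun _ => (0 : ℝ) from funext testDatum_apply_two]
      simp
    have h1 : fderiv ℝ testDatum x (EuclideanSpace.single (2 : Fin 3) (1 : ℝ)) 1 =
        -(fderiv ℝ (fun y : EuclideanSpace ℝ (Fin 3) =>
            fderiv ℝ bumpFn y (EuclideanSpace.single (0 : Fin 3) (1 : ℝ))) x
          (EuclideanSpace.single (2 : Fin 3) (1 : ℝ))) := by
      rw [hcoord, show (fun y => testDatum y 1) = fun y =>
          -(fderiv ℝ bumpFn y (EuclideanSpace.single (0 : Fin 3) (1 : ℝ))) from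
        funext testDatum_apply_one, fderiv_fun_neg]
      simp
    rw [hc0, h2, h1] at hx
    linarith
  -- Step 2: `F` is constant along `x₃`-lines
  have hconst2 : ∀ (x : EuclideanSpace ℝ (Fin 3)) (a b : ℝ),
      fderiv ℝ bumpFn (x + a • EuclideanSpace.single (2 : Fin 3) (1 : ℝ))
          (EuclideanSpace.single (0 : Fin 3) (1 : ℝ)) =
        fderiv ℝ bumpFn (x + b • EuclideanSpace.single (2 : Fin 3) (1 : ℝ))
          (EuclideanSpace.single (0 : Fin 3) (1 : ℝ)) := by
    intro x
    have hderiv : ∀ s : ℝ, HasDerivAt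
        (fun r : ℝ => fderiv ℝ bumpFn (x + r • EuclideanSpace.single (2 : Fin 3) (1 : ℝ))
          (EuclideanSpace.single (0 : Fin 3) (1 : ℝ)))
        (fderiv ℝ (fun y : EuclideanSpace ℝ (Fin 3) =>
            fderiv ℝ bumpFn y (EuclideanSpace.single (0 : Fin 3) (1 : ℝ)))
          (x + s • EuclideanSpace.single (2 : Fin 3) (1 : ℝ))
          (EuclideanSpace.single (2 : Fin 3) (1 : ℝ))) s := by
      intro s
      have hl : HasDerivAt (fun r : ℝ => x + r • EuclideanSpace.single (2 : Fin 3) (1 : ℝ))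
          ((1 : ℝ) • EuclideanSpace.single (2 : Fin 3) (1 : ℝ)) s :=
        ((hasDerivAt_id s).smul_const _).const_add x
      have := (hFd (x + s • EuclideanSpace.single (2 : Fin 3) (1 : ℝ))).hasFDerivAt.comp_hasDerivAt
        s hl
      simpa [Function.comp_def] using this
    exact is_const_of_deriv_eq_zero (fun s => (hderiv s).differentiableAt)
      (fun s => by rw [(hderiv s).deriv, hstep1])
  -- Step 3: `F ≡ 0` (move out of the support of `φ` along `x₃`)
  have hF0 : ∀ x : EuclideanSpace ℝ (Fin 3),
      fderiv ℝ bumpFn x (EuclideanSpace.single (0 : Fin 3) (1 : ℝ)) = 0 := by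
    intro x
    have hfar : fderiv ℝ bumpFn (x + (‖x‖ + 3) • EuclideanSpace.single (2 : Fin 3) (1 : ℝ)) = 0 := by
      apply fderiv_of_notMem_tsupport
      change x + (‖x‖ + 3) • EuclideanSpace.single (2 : Fin 3) (1 : ℝ) ∉
        tsupport (bump : EuclideanSpace ℝ (Fin 3) → ℝ)
      rw [bump.tsupport_eq, Metric.mem_closedBall, dist_zero_right, not_le]
      have he : ‖(‖x‖ + 3) • EuclideanSpace.single (2 : Fin 3) (1 : ℝ)‖ = ‖x‖ + 3 := by
        rw [norm_smul, Real.norm_of_nonneg (by positivity)]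
        simp
      have htri := norm_sub_le (x + (‖x‖ + 3) • EuclideanSpace.single (2 : Fin 3) (1 : ℝ)) x
      rw [add_sub_cancel_left, he] at htri
      simp only [bump]
      linarith
    have := hconst2 x 0 (‖x‖ + 3)
    rw [zero_smul, add_zero] at this
    rw [this, hfar]
    simp
  -- Step 4: `φ` is constant along `x₁`-lines — contradiction (verbatim the landed argument)
  have hderiv : ∀ s : ℝ, HasDerivAt
      (fun r : ℝ => bumpFn (r • EuclideanSpace.single (0 : Fin 3) (1 : ℝ)))
      (fderiv ℝ bumpFn (s • EuclideanSpace.single (0 : Fin 3) (1 : ℝ))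
        (EuclideanSpace.single (0 : Fin 3) (1 : ℝ))) s := fun s => by
    have hφ : DifferentiableAt ℝ bumpFn (s • EuclideanSpace.single (0 : Fin 3) (1 : ℝ)) :=
      (contDiff_bumpFn.differentiable (by simp)) _
    have hl : HasDerivAt (fun r : ℝ => r • EuclideanSpace.single (0 : Fin 3) (1 : ℝ))
        ((1 : ℝ) • EuclideanSpace.single (0 : Fin 3) (1 : ℝ)) s :=
      (hasDerivAt_id s).smul_const _
    have := hφ.hasFDerivAt.comp_hasDerivAt s hl
    simpa [Function.comp_def] using this
  have hconst : ∀ a b : ℝ, bumpFn (a • EuclideanSpace.single (0 : Fin 3) (1 : ℝ)) =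
      bumpFn (b • EuclideanSpace.single (0 : Fin 3) (1 : ℝ)) :=
    is_const_of_deriv_eq_zero (fun s => (hderiv s).differentiableAt)
      (fun s => by rw [(hderiv s).deriv, hF0])
  have h1 : bumpFn ((1 : ℝ) • EuclideanSpace.single (0 : Fin 3) (1 : ℝ)) = 1 := by
    apply bump.one_of_mem_closedBall
    simp [bump]
  have h2 : bumpFn ((2 : ℝ) • EuclideanSpace.single (0 : Fin 3) (1 : ℝ)) = 0 := by
    apply bump.zero_of_le_dist
    simp [bump, norm_smul]
  have := hconst 1 2
  rw [h1, h2] at this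
  exact one_ne_zero this

/-- **The typed norm comparison `NormComparison` is false**: the Beale–Kato–Majda-class solution
issued (by the tree's local existence theorem) from the spread-out datum `x ↦ curl(φe₃)(c x)` has,
at `t = 0`, vorticity with `L²` norm strictly above its `L^∞` norm. -/
theorem not_NormComparison : ¬ Literature.Claims.NS.Ruzmaikina2008.NormComparison := by
  intro H
  -- the undilated vorticity `g = curl testDatum`
  have hgs : ContDiff ℝ ∞ (curl testDatum) :=
    contDiff_curl (n := ⊤) (contDiff_testDatum.of_le (by exact_mod_cast le_top))
  have hgc : HasCompactSupport (curl testDatum) := hasCompactSupport_curl hasCompactSupport_testDatum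
  obtain ⟨c, hcpos, h2fin, hlt⟩ := exists_smul_comp_smul_top_lt hgs.continuous hgc
    curl_testDatum_ne_zero 2 two_ne_zero ENNReal.ofNat_ne_top
  -- the spread-out datum `U = testDatum (c ·)` and its vorticity
  have hcurlU : curl (fun y : EuclideanSpace ℝ (Fin 3) => testDatum (c • y)) =
      fun x => c • curl testDatum (c • x) := funext (curl_comp_smul testDatum c)
  have hUs : ContDiff ℝ ∞ fun y : EuclideanSpace ℝ (Fin 3) => testDatum (c • y) :=
    contDiff_testDatum.comp (contDiff_const_smul c)
  have hUc : HasCompactSupport fun y : EuclideanSpace ℝ (Fin 3) => testDatum (c • y) :=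
    hasCompactSupport_testDatum.comp_smul hcpos.ne'
  have hUdiv : VectorCalculus.IsDivFree fun y : EuclideanSpace ℝ (Fin 3) => testDatum (c • y) :=
    VectorCalculus.IsDivFree.comp_smul (fun x => isDivFree_testDatum x) c
  have hUH : ∀ n : ℕ, ∫⁻ x, ‖iteratedFDeriv ℝ n
      (fun y : EuclideanSpace ℝ (Fin 3) => testDatum (c • y)) x‖ₑ ^ 2 < ⊤ := fun n =>
    (HasRapidSpatialDecay.of_hasCompactSupport hUs hUc).lintegral_enorm_iteratedFDeriv_sq_lt_top n
  -- local existence in the class (Majda–Bertozzi) at viscosity 1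
  have hS : (∑ n ∈ Finset.range 4, ∫⁻ x, ‖iteratedFDeriv ℝ n
      (fun y : EuclideanSpace ℝ (Fin 3) => testDatum (c • y)) x‖ₑ ^ 2) ≠ ⊤ :=
    ENNReal.sum_ne_top.mpr fun n _ => (hUH n).ne
  obtain ⟨τ, hτ, hex⟩ := MajdaBertozzi2002_localExistenceH3_holds (ν := 1) zero_le_one
    ((∑ n ∈ Finset.range 4, ∫⁻ x, ‖iteratedFDeriv ℝ n
      (fun y : EuclideanSpace ℝ (Fin 3) => testDatum (c • y)) x‖ₑ ^ 2).toNNReal)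
  obtain ⟨v, q, hsol, hv0, hB⟩ := hex hUs hUdiv hUH (ENNReal.coe_toNNReal hS).ge
  -- the typed comparison at `q = 2`, `t = 0`
  have hcmp := H 1 0 τ v q one_pos hτ ⟨hsol, hB⟩ 2 le_rfl ENNReal.ofNat_ne_top 0 ⟨le_rfl, hτ.le⟩
  simp only [vortNorm, hv0, hcurlU] at hcmp
  exact absurd hcmp (not_le.mpr (ENNReal.toReal_strict_mono h2fin.ne hlt))

/-- The bare slice form `NormComparisonSlice` (skeleton rev 2: the inequality for the vorticity of any
datum of the class) is false as well, through the skeleton's `normComparison_of_slice`. -/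
theorem not_NormComparisonSlice : ¬ Literature.Claims.NS.Ruzmaikina2008.NormComparisonSlice :=
  fun h => not_NormComparison (normComparison_of_slice h)

end Summit.NavierStokesRegularity.NavierStokesRegularity.Theorems.Ruzmaikina2008

end
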